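import Literature.Geometry.DiscreteGeometry.TriangularLatticeRows
import Literature.Geometry.DiscreteGeometry.HarborthConstruction
import HarnessLib

/-!
# The on-lattice Harborth bound: at most `[3n - √(12n - 3)]` adjacent pairs among `n` points of `A₂`

Sequel to `TriangularLatticeRows.lean` (rows, bonds by direction, the local inequalities) and
`HarborthConstruction.lean` (the spiral attains `[3n - √(12n-3)]`). Source of the statement:
F. Harary, H. Harborth, *Extremal animals* (1976) [HararyHarborth1976], hexagonal animals, as
restated by Gutman–Cyvin 1989, Ch. 3 §3.2 ("`3h + {√(12h-3)} ≤ m`", i.e. at most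
`3h - ⌈√(12h-3)⌉` adjacent pairs of cells; quoted in `TriangularLatticeRows.lean`).

HONEST FRAMING. «On-lattice only; NOT Harborth (5) for free discs, which needs Euler/planar
faces.» What is proved: for discs centred at DISTINCT POINTS OF THE TRIANGULAR LATTICE the number
of touching pairs is at most `⌊3N - √(12N-3)⌋`, and (with `HarborthConstruction.lean`) this is
the exact on-lattice maximum. Nothing is claimed for arbitrary penny packings (the named fact
`Harborth1974_contactNumber` is untouched) and no structure statement (Heitmann–Radin (2)) is made.

## The proof (ours; not Harary–Harborth's)

Let the occupied rows be `t₀ < … < t_{h-1}` with `kᵢ` labels, and `Eᵢ` bonds between row `tᵢ`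
and row `tᵢ + 1` (`= 0` unless `tᵢ + 1 = tᵢ₊₁`). By `TriangularLatticeRows`: the number of
adjacent pairs is `e = horizBonds + ∑ Eᵢ ≤ (n - h) + ∑_{i<h-1} Eᵢ` with
`Eᵢ ≤ min(2kᵢ, 2kᵢ₊₁, kᵢ + kᵢ₊₁ - 1)`. The one-dimensional lemma `seq_lemma`: for such data,
every `D ≥ 2n + h - ∑E` satisfies `12 n ≤ D² + 3` — put `xᵢ = k₀ + ∑_{j<i} (kⱼ + kⱼ₊₁ - Eⱼ)`
(strictly increasing integers), then `kᵢ ≤ min(xᵢ, W - xᵢ)` with `W + h = 2n + h - ∑E`; splitting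
the indices at `xᵢ ≤ ⌊W/2⌋` and summing two arithmetic progressions gives
`(W+h)² + 3 - 12n = 4(w-h)² + 3(2p-h-1)²` (`W = 2w`) resp. `(2(w-h)+1)² + 3(2p-h)² + 3`
(`W = 2w+1`) `≥ 0`. With `D = 3n - e` this is `(3n - e)² + 3 ≥ 12n`, i.e. `e ≤ 3n - √(12n-3)`.

## Results

* `HarborthSpiral.twelve_mul_card_le` — `12 n ≤ (3n - e)² + 3` and `e < 3n` for non-empty `S`
  (and `twelve_mul_card_le_of_slack`: `12 n ≤ (3n - e - g)² + 3` whenever the rows carry at most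
  `n - #rows - g` horizontal bonds).
* `adjCount_le_two_mul_harborthNumber` — `adjCount S ≤ 2 ⌊3n - √(12n-3)⌋` for every finite `S`.
* `adjCount_add_two_le_of_row_gap`, `HarborthSpiral.mem_of_adjCount_eq` — a row with a gap costs a
  contact (`adjCount S + 2 ≤ 2 ⌊3n - √(12n-3)⌋`); hence every configuration ATTAINING the bound
  is row-convex (each horizontal row an integer interval) — the row form of "ground states have
  no holes", used by `TriangularLatticeEdgeIsoperimetry.lean` (Davoli–Piovano–Stefanelli 2017,
  Theorem 1.1).
* `contactPairCount_triPoint_le_harborthNumber` — discs at distinct lattice points touch in at most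
  `harborthNumber N` pairs.
* `isGreatest_contactPairCount_triPoint` — the on-lattice contact number of `N` discs is exactly
  `harborthNumber N = ⌊3N - √(12N-3)⌋` (upper bound here, attainment `HarborthConstruction.lean`).
-/

noncomputable section

namespace Literature.Geometry.DiscreteGeometry

open Finset
open Literature.MathematicalPhysics.StatisticalMechanics

namespace HarborthSpiral

/-- **The one-dimensional lemma.** For row sizes `k₀,…,k_{h-1} ≥ 1` and inter-row bond counts
`E_i ≤ min(2k_i, 2k_{i+1}, k_i + k_{i+1} - 1)`, every `D ≥ 2∑k + h - ∑E` satisfies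
`12 ∑ k ≤ D² + 3`. Proof: `x_i = k₀ + ∑_{j<i}(k_j + k_{j+1} - E_j)` is strictly increasing with
`k_i ≤ min(x_i, W - x_i)`, `W + h = 2∑k + h - ∑E`; splitting at `x_i ≤ ⌊W/2⌋` and summing two
arithmetic progressions leaves the sums of squares `4(w-h)² + 3(2p-h-1)²`, resp.
`(2(w-h)+1)² + 3(2p-h)² + 3`. [folklore] -/
private theorem seq_lemma (h : ℕ) (hh : 1 ≤ h) (k E : ℕ → ℤ)
    (hk : ∀ i, i < h → 1 ≤ k i)
    (hE1 : ∀ i, i + 1 < h → E i ≤ 2 * k i)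
    (hE2 : ∀ i, i + 1 < h → E i ≤ 2 * k (i + 1))
    (hE3 : ∀ i, i + 1 < h → E i + 1 ≤ k i + k (i + 1)) (D : ℤ)
    (hD : 2 * (∑ i ∈ range h, k i) + h - ∑ i ∈ range (h - 1), E i ≤ D) :
    12 * (∑ i ∈ range h, k i) ≤ D ^ 2 + 3 ∧
      0 < 2 * (∑ i ∈ range h, k i) + h - ∑ i ∈ range (h - 1), E i := by
  -- the strictly increasing comparison sequence
  set x : ℕ → ℤ := fun i => k 0 + ∑ j ∈ range i, (k j + k (j + 1) - E j) with hxdef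
  have hx0 : x 0 = k 0 := by simp [hxdef]
  have hx_succ : ∀ i, x (i + 1) = x i + (k i + k (i + 1) - E i) := by
    intro i; simp only [hxdef, sum_range_succ]; ring
  -- strict monotonicity
  have hmono : ∀ d i, i + d < h → x i + d ≤ x (i + d) := by
    intro d
    induction d with
    | zero => intro i _; simp
    | succ d ih =>
      intro i hi
      have h1 := ih i (by omega)
      have h2 := hE3 (i + d) (by omega)
      rw [← add_assoc, hx_succ]
      push_cast
      linarith
  -- k i ≤ x i
  have hleft : ∀ i, i < h → k i ≤ x i := by
    intro i
    induction i with
    | zero => intro _; rw [hx0]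
    | succ i ih =>
      intro hi
      rw [hx_succ]
      have := ih (by omega)
      have := hE1 i hi
      linarith
  -- k i ≤ W - x i
  set W := x (h - 1) + k (h - 1) with hWdef
  have hright : ∀ d i, i + d = h - 1 → k i ≤ W - x i := by
    intro d
    induction d with
    | zero => intro i hi; rw [add_zero] at hi; subst hi; simp [hWdef]
    | succ d ih =>
      intro i hi
      have h1 := ih (i + 1) (by omega)
      have h2 := hE2 i (by omega)
      rw [hx_succ] at h1
      linarith
  -- W = 2n - ΣE
  have hW : W = 2 * (∑ i ∈ range h, k i) - ∑ i ∈ range (h - 1), E i := by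
    obtain ⟨m, rfl⟩ : ∃ m, h = m + 1 := ⟨h - 1, by omega⟩
    have e1 : ∑ i ∈ range m, k (i + 1) + k 0 = ∑ i ∈ range m, k i + k m := by
      rw [← sum_range_succ', sum_range_succ]
    simp only [hWdef, hxdef, Nat.add_sub_cancel, sum_sub_distrib, sum_add_distrib, sum_range_succ]
    linarith [e1]
  -- Gauss sums, in the form we need
  have gauss : ∀ n : ℕ, 2 * ∑ j ∈ range n, (j : ℤ) = n * (n - 1) := by
    intro n
    induction n with
    | zero => simp
    | succ n ih => rw [sum_range_succ, mul_add, ih]; push_cast; ring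
  -- parity of W and the threshold w = ⌊W/2⌋
  obtain ⟨w, hw⟩ := Int.even_or_odd' W
  have hwle : ∀ z : ℤ, 2 * z ≤ W → z ≤ w := by intro z hz; omega
  have hwge : ∀ z : ℤ, ¬ 2 * z ≤ W → w + 1 ≤ z := by intro z hz; omega
  -- the indices below the threshold form an initial segment `[0, p)`
  set F := (range h).filter (fun i => 2 * x i ≤ W) with hFdef
  set p := F.card with hpdef
  have hFsub : F ⊆ range h := filter_subset _ _
  have hph : p ≤ h := by simpa using card_le_card hFsub
  have hlower : ∀ i j, j ∈ F → i ≤ j → i ∈ F := by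
    intro i j hj hij
    rw [hFdef, mem_filter, mem_range] at hj ⊢
    refine ⟨by omega, ?_⟩
    have h1 := hmono (j - i) i (by omega)
    rw [show i + (j - i) = j by omega] at h1
    have h2 : (0 : ℤ) ≤ ((j - i : ℕ) : ℤ) := Int.natCast_nonneg _
    linarith [hj.2]
  have hF_of_lt : ∀ i, i < p → i ∈ F := by
    intro i hi
    by_contra hni
    have hsub : F ⊆ range i := by
      intro j hj
      rw [mem_range]
      by_contra hji
      exact hni (hlower i j hj (by omega))
    have := card_le_card hsub
    rw [card_range] at this
    omega
  have hlt_of_F : ∀ i, i ∈ F → i < p := by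
    intro i hi
    have hsub : range (i + 1) ⊆ F := by
      intro j hj
      rw [mem_range] at hj
      exact hlower j i hi (by omega)
    have := card_le_card hsub
    rw [card_range] at this
    omega
  -- bounds on k below and above the threshold
  have hk_low : ∀ i, i < p → k i ≤ w - ((p : ℤ) - 1 - i) := by
    intro i hi
    have hp1 : p - 1 ∈ F := hF_of_lt (p - 1) (by omega)
    have hxp : x (p - 1) ≤ w := hwle _ (by rw [hFdef, mem_filter] at hp1; exact hp1.2)
    have h1 := hmono (p - 1 - i) i (by omega)
    rw [show i + (p - 1 - i) = p - 1 by omega] at h1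
    have h2 := hleft i (by omega)
    have h3 : ((p - 1 - i : ℕ) : ℤ) = (p : ℤ) - 1 - i := by
      rw [Nat.cast_sub (by omega), Nat.cast_sub (by omega)]; push_cast; ring
    linarith
  have hk_high : ∀ i, p ≤ i → i < h → k i ≤ W - w - 1 - ((i : ℤ) - p) := by
    intro i hpi hi
    have hpF : p ∉ F := fun hh' => lt_irrefl _ (hlt_of_F p hh')
    have hxp : w + 1 ≤ x p := hwge _ (by
      intro hc; exact hpF (by rw [hFdef, mem_filter, mem_range]; exact ⟨by omega, hc⟩))
    have h1 := hmono (i - p) p (by omega)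
    rw [show p + (i - p) = i by omega] at h1
    have h2 := hright (h - 1 - i) i (by omega)
    have h3 : ((i - p : ℕ) : ℤ) = (i : ℤ) - p := by rw [Nat.cast_sub hpi]
    linarith
  -- summing the bounds
  have hS1 : 2 * ∑ i ∈ range p, k i ≤ 2 * p * w - p * ((p : ℤ) - 1) := by
    have h1 : ∑ i ∈ range p, k i ≤ ∑ i ∈ range p, (w - ((p : ℤ) - 1 - i)) :=
      sum_le_sum fun i hi => hk_low i (mem_range.1 hi)
    have h2 : ∑ i ∈ range p, (w - ((p : ℤ) - 1 - i)) =
        p * w - p * ((p : ℤ) - 1) + ∑ i ∈ range p, (i : ℤ) := by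
      rw [sum_sub_distrib, sum_sub_distrib, sum_const, sum_const, card_range]
      simp only [nsmul_eq_mul]
      ring
    have h3 := gauss p
    linarith
  have hS2 : 2 * ∑ i ∈ Ico p h, k i ≤
      2 * ((h : ℤ) - p) * (W - w - 1) - ((h : ℤ) - p) * ((h : ℤ) - p - 1) := by
    have h1 : ∑ i ∈ Ico p h, k i ≤ ∑ i ∈ Ico p h, (W - w - 1 - ((i : ℤ) - p)) :=
      sum_le_sum fun i hi => hk_high i (mem_Ico.1 hi).1 (mem_Ico.1 hi).2
    have h2 : ∑ i ∈ Ico p h, (W - w - 1 - ((i : ℤ) - p)) =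
        ∑ j ∈ range (h - p), (W - w - 1 - (j : ℤ)) := by
      rw [sum_Ico_eq_sum_range]
      refine sum_congr rfl fun j _ => ?_
      push_cast
      ring
    have h3 : ∑ j ∈ range (h - p), (W - w - 1 - (j : ℤ)) =
        ((h - p : ℕ) : ℤ) * (W - w - 1) - ∑ j ∈ range (h - p), (j : ℤ) := by
      rw [sum_sub_distrib, sum_const, card_range]
      simp only [nsmul_eq_mul]
    have h4 := gauss (h - p)
    have h5 : ((h - p : ℕ) : ℤ) = (h : ℤ) - p := by rw [Nat.cast_sub hph]
    rw [h5] at h3 h4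
    linarith
  have hsplit : ∑ i ∈ range h, k i = ∑ i ∈ range p, k i + ∑ i ∈ Ico p h, k i := by
    rw [range_eq_Ico, range_eq_Ico]
    exact (sum_Ico_consecutive _ (Nat.zero_le p) hph).symm
  -- the final quadratic inequality
  have hWh : 2 * ∑ i ∈ range h, k i + (h : ℤ) - ∑ i ∈ range (h - 1), E i = W + h := by
    rw [hW]; ring
  rw [hWh] at hD ⊢
  have hWpos : 0 < W + h := by
    have h1 := hleft 0 (by omega)
    have h2 := hright (h - 1) 0 (by omega)
    have h3 := hk 0 (by omega)
    have h4 : (1 : ℤ) ≤ h := by exact_mod_cast hh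
    linarith
  refine ⟨?_, hWpos⟩
  have hsq : (W + h) ^ 2 ≤ D ^ 2 := by nlinarith
  suffices hmain : 12 * ∑ i ∈ range h, k i ≤ (W + h) ^ 2 + 3 by linarith
  rw [hsplit]
  have hp0 : (0 : ℤ) ≤ p := Int.natCast_nonneg _
  have hq0 : (p : ℤ) ≤ h := by exact_mod_cast hph
  rcases hw with hw | hw
  · rw [hw] at hS2 ⊢
    nlinarith [sq_nonneg (w - (h : ℤ)), sq_nonneg ((p : ℤ) - ((h : ℤ) - p) - 1)]
  · rw [hw] at hS2 ⊢
    nlinarith [sq_nonneg (2 * (w - (h : ℤ)) + 1), sq_nonneg ((p : ℤ) - ((h : ℤ) - p))]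

/-! ## Sorting the rows and assembling the bound -/

/-- An empty upper row carries no bonds. [folklore] -/
private theorem rowBonds_eq_zero_of_empty (S : Finset (ℤ × ℤ)) (t : ℤ)
    (h : row S (t + 1) = ∅) : rowBonds S t = 0 := by
  unfold rowBonds
  rw [h]
  simp only [notMem_empty, filter_false, card_empty]

/-- **On-lattice Harborth bound, squared form with a horizontal slack.** If the rows of a
non-empty `S` carry at most `|S| - #rows - g` horizontal bonds (the basic bound has `g = 0`; a row
with a gap gives `g = 1`, `horizBonds_add_card_rows_add_one_le`), then with
`e = horizBonds + vertBonds + diagBonds`: `12 n ≤ (3n - e - g)² + 3` and `e + g < 3n` — the same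
one-dimensional lemma, fed with `D = 3n - e - g`. [cite: HararyHarborth1976, hexagonal animals] -/
theorem twelve_mul_card_le_of_slack (S : Finset (ℤ × ℤ)) (hS : S.Nonempty) (g : ℕ)
    (hg : horizBonds S + (S.image Prod.snd).card + g ≤ S.card) :
    12 * (S.card : ℤ) ≤
        (3 * (S.card : ℤ) - (horizBonds S + vertBonds S + diagBonds S + g : ℕ)) ^ 2 + 3 ∧
      ((horizBonds S + vertBonds S + diagBonds S + g : ℕ) : ℤ) < 3 * S.card := by
  -- the sorted occupied rows
  set T := S.image Prod.snd with hT
  have hTne : T.Nonempty := hS.image _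
  set h := T.card with hh
  have hh1 : 1 ≤ h := hTne.card_pos
  let r : Fin h ↪o ℤ := T.orderEmbOfFin rfl
  let rr : ℕ → ℤ := fun i => if hi : i < h then r ⟨i, hi⟩ else 0
  have hrr : ∀ i (hi : i < h), rr i = r ⟨i, hi⟩ := fun i hi => dif_pos hi
  have hrmem : ∀ i (hi : i < h), rr i ∈ T := fun i hi => by
    rw [hrr i hi]; exact T.orderEmbOfFin_mem rfl _
  have hrsurj : ∀ t ∈ T, ∃ i, ∃ hi : i < h, rr i = t := by
    intro t ht
    have : t ∈ Set.range r := by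
      rw [Finset.range_orderEmbOfFin]; exact ht
    obtain ⟨⟨i, hi⟩, hit⟩ := this
    exact ⟨i, hi, by rw [hrr i hi, hit]⟩
  have hrlt : ∀ i j (hi : i < h) (hj : j < h), rr i < rr j ↔ i < j := by
    intro i j hi hj
    rw [hrr i hi, hrr j hj]
    exact r.lt_iff_lt
  -- consecutive sorted rows: either adjacent or separated by an empty row
  have hnext : ∀ i, i + 1 < h → (row S (rr i + 1)).Nonempty → rr (i + 1) = rr i + 1 := by
    intro i hi hne
    obtain ⟨j, hj, hjt⟩ := hrsurj _ (row_nonempty_iff.1 hne)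
    have hij : i < j := (hrlt i j (by omega) hj).1 (by rw [hjt]; omega)
    have h1 : rr i < rr (i + 1) := (hrlt i (i + 1) (by omega) hi).2 (by omega)
    have h2 : rr (i + 1) ≤ rr j := by
      rcases Nat.lt_or_ge (i + 1) j with hlt | hge
      · exact ((hrlt (i + 1) j hi hj).2 hlt).le
      · have : j = i + 1 := by omega
        subst this; exact le_rfl
    omega
  have htop : row S (rr (h - 1) + 1) = ∅ := by
    by_contra hne
    obtain ⟨j, hj, hjt⟩ := hrsurj _ (row_nonempty_iff.1 (nonempty_iff_ne_empty.2 hne))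
    have : rr (h - 1) < rr j := by rw [hjt]; omega
    have := (hrlt (h - 1) j (by omega) hj).1 this
    omega
  -- the data of the one-dimensional lemma
  let k : ℕ → ℤ := fun i => ((row S (rr i)).card : ℤ)
  let E : ℕ → ℤ := fun i => (rowBonds S (rr i) : ℤ)
  have hk : ∀ i, i < h → 1 ≤ k i := fun i hi =>
    Int.toNat_le.mp ((row_nonempty_iff.2 (hrmem i hi)).card_pos)
  have hE1 : ∀ i, i + 1 < h → E i ≤ 2 * k i := fun i _ => by
    simp only [E, k]
    exact_mod_cast rowBonds_le_two_mul S (rr i)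
  have hE2 : ∀ i, i + 1 < h → E i ≤ 2 * k (i + 1) := by
    intro i hi
    by_cases hne : (row S (rr i + 1)).Nonempty
    · have := rowBonds_le_two_mul' S (rr i)
      rw [← hnext i hi hne] at this
      simp only [E, k]
      exact_mod_cast this
    · have h0 := rowBonds_eq_zero_of_empty S (rr i) (not_nonempty_iff_eq_empty.1 hne)
      have := hk (i + 1) hi
      simp only [E, h0, Nat.cast_zero]
      linarith
  have hE3 : ∀ i, i + 1 < h → E i + 1 ≤ k i + k (i + 1) := by
    intro i hi
    by_cases hne : (row S (rr i + 1)).Nonempty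
    · have := rowBonds_add_one_le S (rr i) hne
      rw [← hnext i hi hne] at this
      simp only [E, k]
      exact_mod_cast this
    · have h0 := rowBonds_eq_zero_of_empty S (rr i) (not_nonempty_iff_eq_empty.1 hne)
      have h1 := hk i (by omega)
      have h2 := hk (i + 1) hi
      simp only [E, h0, Nat.cast_zero]
      linarith
  -- sums over the occupied rows are sums over `range h`
  have hsumT : ∀ f : ℤ → ℤ, ∑ t ∈ T, f t = ∑ i ∈ range h, f (rr i) := by
    intro f
    rw [Finset.sum_range, ← Finset.sum_image (f := f) (s := univ) (g := fun i : Fin h => rr i)]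
    · congr 1
      ext t
      simp only [mem_image, mem_univ, true_and]
      constructor
      · intro ht
        obtain ⟨i, hi, hit⟩ := hrsurj t ht
        exact ⟨⟨i, hi⟩, hit⟩
      · rintro ⟨⟨i, hi⟩, rfl⟩
        exact hrmem i hi
    · rintro ⟨i, hi⟩ _ ⟨j, hj⟩ _ (hij : rr i = rr j)
      ext
      by_contra hne
      rcases Nat.lt_or_gt_of_ne hne with hlt | hlt
      · exact absurd hij (ne_of_lt ((hrlt i j hi hj).2 hlt))
      · exact absurd hij (ne_of_gt ((hrlt j i hj hi).2 hlt))
  have hn : (S.card : ℤ) = ∑ i ∈ range h, k i := by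
    rw [card_eq_sum_card_row, Nat.cast_sum]
    exact hsumT fun t => ((row S t).card : ℤ)
  have hVD : ((vertBonds S + diagBonds S : ℕ) : ℤ) = ∑ i ∈ range (h - 1), E i := by
    rw [vertBonds_add_diagBonds_eq_sum, Nat.cast_sum, hsumT fun t => (rowBonds S t : ℤ)]
    obtain ⟨m, hm⟩ : ∃ m, h = m + 1 := ⟨h - 1, by omega⟩
    have h0 : rowBonds S (rr m) = 0 := by
      have := rowBonds_eq_zero_of_empty S (rr (h - 1)) htop
      rwa [hm, Nat.add_sub_cancel] at this
    rw [hm, sum_range_succ, Nat.add_sub_cancel, h0, Nat.cast_zero, add_zero]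
  have hH : ((horizBonds S : ℕ) : ℤ) + h + g ≤ S.card := by exact_mod_cast hg
  -- apply the one-dimensional lemma with `D = 3n - e - g`
  have hD : 2 * (∑ i ∈ range h, k i) + h - ∑ i ∈ range (h - 1), E i ≤
      3 * (S.card : ℤ) - (horizBonds S + vertBonds S + diagBonds S + g : ℕ) := by
    push_cast
    rw [← hn]
    have := hVD
    push_cast at this
    linarith
  obtain ⟨h1, h2⟩ := seq_lemma h hh1 k E hk hE1 hE2 hE3 _ hD
  rw [← hn] at h1
  exact ⟨h1, by linarith⟩

/-- **On-lattice Harborth bound, squared form.** For a non-empty finite set `S` of labels of the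
triangular lattice with `n` labels and `e = horizBonds + vertBonds + diagBonds` adjacent pairs:
`12 n ≤ (3n - e)² + 3` and `e < 3n`. [cite: HararyHarborth1976, hexagonal animals] -/
theorem twelve_mul_card_le (S : Finset (ℤ × ℤ)) (hS : S.Nonempty) :
    12 * (S.card : ℤ) ≤ (3 * (S.card : ℤ) - (horizBonds S + vertBonds S + diagBonds S : ℕ)) ^ 2 + 3 ∧
      ((horizBonds S + vertBonds S + diagBonds S : ℕ) : ℤ) < 3 * S.card := by
  simpa using twelve_mul_card_le_of_slack S hS 0 (by simpa using horizBonds_add_card_rows_le S)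

/-! ## Rows with a gap: the slack `g = 1` -/

/-- In a finite row with a GAP (`a < m < c`, `a, c` present, `m` absent) the labels with a right
neighbour are all but at least TWO: the last one, and the last one before the gap.
[cite: HararyHarborth1976, hexagonal animals] -/
theorem card_filter_succ_mem_add_two_le (R : Finset ℤ) {a m c : ℤ} (ha : a ∈ R) (hc : c ∈ R)
    (hm : m ∉ R) (ham : a < m) (hmc : m < c) :
    (R.filter fun x => x + 1 ∈ R).card + 2 ≤ R.card := by
  have hR : R.Nonempty := ⟨a, ha⟩
  set L := R.filter fun x => x < m with hL
  have hLne : L.Nonempty := ⟨a, by rw [hL, mem_filter]; exact ⟨ha, ham⟩⟩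
  set b := L.max' hLne with hb
  have hbL : b ∈ L := L.max'_mem hLne
  have hbR : b ∈ R := (mem_filter.1 hbL).1
  have hbm : b < m := (mem_filter.1 hbL).2
  -- `b + 1 ∉ R`
  have hb1 : b + 1 ∉ R := by
    intro h
    rcases lt_or_ge (b + 1) m with h1 | h1
    · have : b + 1 ∈ L := by rw [hL, mem_filter]; exact ⟨h, h1⟩
      have := L.le_max' _ this
      omega
    · have : b + 1 = m := by omega
      exact hm (this ▸ h)
  -- `b` is not the last label
  have hbmax : b ≠ R.max' hR := by
    intro h
    have := R.le_max' _ hc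
    omega
  have hsub : (R.filter fun x => x + 1 ∈ R) ⊆ (R.erase (R.max' hR)).erase b := by
    intro x hx
    rw [mem_filter] at hx
    rw [mem_erase, mem_erase]
    refine ⟨fun h => hb1 (h ▸ hx.2), fun h => ?_, hx.1⟩
    have := R.le_max' _ hx.2
    omega
  have h1 := card_le_card hsub
  rw [card_erase_of_mem (mem_erase.2 ⟨hbmax, hbR⟩), card_erase_of_mem (R.max'_mem hR)] at h1
  have h2 : 2 ≤ R.card := by
    have : ({a, c} : Finset ℤ) ⊆ R := by
      intro x hx
      rw [mem_insert, mem_singleton] at hx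
      rcases hx with rfl | rfl <;> assumption
    have := card_le_card this
    rwa [card_pair (by omega)] at this
  omega

/-- **A row with a gap costs a horizontal bond**: if row `t` of `S` contains `a < m < c` with
`(a,t), (c,t) ∈ S`, `(m,t) ∉ S`, then `horizBonds S + #rows + 1 ≤ |S|`.
[cite: HararyHarborth1976, hexagonal animals] -/
theorem horizBonds_add_card_rows_add_one_le (S : Finset (ℤ × ℤ)) {t a m c : ℤ}
    (ha : (a, t) ∈ S) (hc : (c, t) ∈ S) (hm : (m, t) ∉ S) (ham : a < m) (hmc : m < c) :
    horizBonds S + (S.image Prod.snd).card + 1 ≤ S.card := by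
  have ht : t ∈ S.image Prod.snd := mem_image.2 ⟨(a, t), ha, rfl⟩
  rw [horizBonds_eq_sum, card_eq_sum_ones (S.image Prod.snd), card_eq_sum_card_row,
    ← sum_erase_add _ _ ht, ← sum_erase_add _ _ ht, ← sum_erase_add (S.image Prod.snd) _ ht]
  have hrest : ∑ x ∈ (S.image Prod.snd).erase t, ((row S x).filter fun m => m + 1 ∈ row S x).card +
      ∑ x ∈ (S.image Prod.snd).erase t, 1 ≤ ∑ x ∈ (S.image Prod.snd).erase t, (row S x).card := by
    rw [← sum_add_distrib]
    refine sum_le_sum fun x hx => ?_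
    exact card_filter_succ_mem_add_one_le _ (row_nonempty_iff.2 (mem_of_mem_erase hx))
  have hgap : ((row S t).filter fun m => m + 1 ∈ row S t).card + 2 ≤ (row S t).card :=
    card_filter_succ_mem_add_two_le (row S t) (mem_row.2 ha) (mem_row.2 hc)
      (fun h => hm (mem_row.1 h)) ham hmc
  omega

end HarborthSpiral

open HarborthSpiral

/-- **On-lattice Harborth bound (Harary–Harborth 1976, hexagonal animals).** A finite set `S` of
`n` labels of the triangular lattice `A₂` has at most `[3n - √(12n - 3)]` adjacent pairs
(`adjCount` counts them from both ends). Equivalently (Gutman–Cyvin §3.2, quoting Harary–Harborth):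
a hexagonal animal with `h` cells has `m ≥ 3h + ⌈√(12h - 3)⌉` edges, i.e. at most
`3h - ⌈√(12h-3)⌉` pairs of adjacent cells. The proof here is NOT Harary–Harborth's: rows +
the one-dimensional lemma `seq_lemma`. [cite: HararyHarborth1976, hexagonal animals (restated in GutmanCyvin1989, §3.2)] -/
theorem adjCount_le_two_mul_harborthNumber (S : Finset (ℤ × ℤ)) :
    (adjCount S : ℤ) ≤ 2 * harborthNumber S.card := by
  rcases S.eq_empty_or_nonempty with rfl | hS
  · simp [adjCount, harborthNumber_zero]
  obtain ⟨h1, h2⟩ := twelve_mul_card_le S hS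
  rw [adjCount_eq_two_mul]
  set e := horizBonds S + vertBonds S + diagBonds S
  have he : (e : ℤ) ≤ harborthNumber S.card := by
    rw [harborthNumber, Int.le_floor]
    have hnn' : (0 : ℤ) ≤ 3 * (S.card : ℤ) - e := by linarith
    have hsq' : 12 * (S.card : ℤ) - 3 ≤ (3 * (S.card : ℤ) - e) ^ 2 := by linarith
    have hnn : (0 : ℝ) ≤ 3 * (S.card : ℝ) - e := by exact_mod_cast hnn'
    have hsq : (12 * (S.card : ℝ) - 3) ≤ (3 * (S.card : ℝ) - e) ^ 2 := by exact_mod_cast hsq'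
    have h3 := Real.sqrt_le_sqrt hsq
    rw [Real.sqrt_sq hnn] at h3
    push_cast
    linarith
  push_cast
  linarith

/-- **A row with a gap costs a contact.** If some horizontal row of `S` is not an integer interval
(`(a,t), (c,t) ∈ S`, `(m,t) ∉ S`, `a < m < c`), then `S` has at most `[3n - √(12n - 3)] - 1`
adjacent pairs: `adjCount S + 2 ≤ 2 [3n - √(12n-3)]`. (The slack `g = 1` in the squared bound;
`⌊x - 1⌋ = ⌊x⌋ - 1`.) [cite: HararyHarborth1976, hexagonal animals] -/
theorem adjCount_add_two_le_of_row_gap (S : Finset (ℤ × ℤ)) {t a m c : ℤ}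
    (ha : (a, t) ∈ S) (hc : (c, t) ∈ S) (hm : (m, t) ∉ S) (ham : a < m) (hmc : m < c) :
    (adjCount S : ℤ) + 2 ≤ 2 * harborthNumber S.card := by
  have hS : S.Nonempty := ⟨_, ha⟩
  obtain ⟨h1, h2⟩ := twelve_mul_card_le_of_slack S hS 1
    (horizBonds_add_card_rows_add_one_le S ha hc hm ham hmc)
  rw [adjCount_eq_two_mul]
  set e := horizBonds S + vertBonds S + diagBonds S
  have he : (e : ℤ) + 1 ≤ harborthNumber S.card := by
    rw [harborthNumber, Int.le_floor]
    push_cast at h1 h2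
    have hnn' : (0 : ℤ) ≤ 3 * (S.card : ℤ) - (e + 1) := by linarith
    have hsq' : 12 * (S.card : ℤ) - 3 ≤ (3 * (S.card : ℤ) - (e + 1)) ^ 2 := by linarith
    have hnn : (0 : ℝ) ≤ 3 * (S.card : ℝ) - (e + 1) := by exact_mod_cast hnn'
    have hsq : (12 * (S.card : ℝ) - 3) ≤ (3 * (S.card : ℝ) - (e + 1)) ^ 2 := by exact_mod_cast hsq'
    have h3 := Real.sqrt_le_sqrt hsq
    rw [Real.sqrt_sq hnn] at h3
    push_cast
    linarith
  push_cast
  linarith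

/-- **Contact maximizers on `A₂` are row-convex.** If `S` attains the on-lattice maximum
`[3n - √(12n-3)]` of adjacent pairs (`2 [3n - √(12n-3)] ≤ adjCount S`), then every horizontal row
of `S` is an integer interval: `(a,t), (c,t) ∈ S`, `a ≤ m ≤ c` imply `(m,t) ∈ S`. (By the
symmetries of `A₂` the same holds for the rows in the other two lattice directions; only the
horizontal form is recorded.) [cite: HararyHarborth1976, hexagonal animals] -/
theorem HarborthSpiral.mem_of_adjCount_eq {S : Finset (ℤ × ℤ)}
    (hmax : 2 * harborthNumber S.card ≤ (adjCount S : ℤ)) {t a m c : ℤ}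
    (ha : (a, t) ∈ S) (hc : (c, t) ∈ S) (ham : a ≤ m) (hmc : m ≤ c) : (m, t) ∈ S := by
  by_contra hm
  rcases eq_or_lt_of_le ham with rfl | ham'
  · exact hm ha
  rcases eq_or_lt_of_le hmc with rfl | hmc'
  · exact hm hc
  have := adjCount_add_two_le_of_row_gap S ha hc hm ham' hmc'
  linarith

/-- **On-lattice Harborth bound for discs.** `N` unit discs centred at distinct points of the
triangular lattice `A₂` touch in at most `[3N - √(12N - 3)]` pairs. (On-lattice only: this is NOT
Harborth's (5) for free discs, whose printed proofs use Euler's formula for the plane contact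
graph.) [cite: HararyHarborth1976, hexagonal animals (restated in GutmanCyvin1989, §3.2)] -/
theorem contactPairCount_triPoint_le_harborthNumber {N : ℕ} (c : Fin N → ℤ × ℤ)
    (hc : Function.Injective c) :
    (contactPairCount (fun i => Theil2006.triPoint (c i)) : ℤ) ≤ harborthNumber N := by
  have h1 := two_mul_contactPairCount_triPoint c hc
  have h2 := adjCount_le_two_mul_harborthNumber (univ.image c)
  rw [card_image_of_injective _ hc, card_univ, Fintype.card_fin] at h2
  have h3 : (adjCount (univ.image c) : ℤ) =
      2 * contactPairCount (fun i => Theil2006.triPoint (c i)) := by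
    exact_mod_cast h1.symm
  linarith

/-- **The on-lattice contact number is exactly `[3N - √(12N - 3)]`** (Harary–Harborth 1976 upper
bound + Harborth 1974 (6) spiral construction): the greatest number of touching pairs among `N`
unit discs centred at distinct points of `A₂`. [cite: HararyHarborth1976, hexagonal animals (restated in GutmanCyvin1989, §3.2)] -/
theorem isGreatest_contactPairCount_triPoint (N : ℕ) :
    IsGreatest {z : ℤ | ∃ c : Fin N → ℤ × ℤ, Function.Injective c ∧
      z = contactPairCount (fun i => Theil2006.triPoint (c i))} (harborthNumber N) := by
  constructor
  · obtain ⟨c, hc, h⟩ := exists_injective_contactPairCount_eq_harborthNumber N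
    exact ⟨c, hc, h.symm⟩
  · rintro z ⟨c, hc, rfl⟩
    exact contactPairCount_triPoint_le_harborthNumber c hc

end Literature.Geometry.DiscreteGeometry

end
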